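import Literature.Barriers.QuantumAdvantage.SupremacyTheoremsNonRelativizing
import Literature.Computability.Cryptography.OneWayFunctions
import Literature.Computability.Complexity.CircuitClasses
import HarnessLib
import HarnessLib.Audit
import Summits.PneNP.PneNP.Theorems.OWFExist

/-!
# Barrier catalogue `QuantumAdvantage`: separations relative to efficiently computable (`P/poly`) oracles need unrelativized assumptions (Aaronson–Chen 2017, Thms. 7.6 and 8.1)

D-0021 barrier entry for the summit `QuantumAdvantage`
(`Summits/QuantumAdvantage/QuantumAdvantage/Statement.lean`:
`QuantumAdvantage := ∃ L, L ∈ BQP ∧ L ∉ BPP`). Companion to `Relativization.lean` (designed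
oracles), `RandomOracleMethod.lean` (random oracles) and `SupremacyTheoremsNonRelativizing.lean`
(whose relativized sampling classes `SampPRel`, `SampBQPRel` are reused).

**The printed results.** S. Aaronson, L. Chen, *Complexity-theoretic foundations of quantum
supremacy experiments*, CCC 2017 (arXiv:1612.05903, whose numbering we follow) [AaronsonChen2017]:

* §1 (p. 9): "what happens if we consider quantum sampling algorithms that can access an
  oracle, but we impose a constraint that the oracle has to be 'physically realistic'? One natural
  requirement here is that the oracle function `f` be computable in the class `P/poly` …
  Could quantum supremacy be proven unconditionally then?"
* **Thm. 7.6**: "Assuming one-way functions exist, there exists an oracle `O ∈ P/poly` such that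
  `BPP^O ≠ BQP^O`." ("the one-way functions only need to be hard to invert classically, not
  quantumly", §1 p. 9.)
* **Thm. 8.1**: "Suppose `SampBPP = SampBQP` and `NP ⊆ BPP`. Then for every oracle `O ∈ P/poly`,
  we have `SampBPP^O = SampBQP^O` (and consequently `BPP^O = BQP^O`)." §1 (p. 9): "Or
  equivalently: if we want to separate quantum from classical approximate sampling relative to
  efficiently computable oracles, then we need to assume something about the unrelativized
  world: either `SampBPP ≠ SampBQP` (in which case we wouldn't even need an oracle), or else
  `NP ⊄ BPP`."
* §1 (p. 10): the "smooth tradeoff": some oracle (even random) — unconditional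
  `SampBPP ≠ SampBQP`; efficiently computable oracle — under one-way functions; no oracle —
  only under special assumptions (factoring, permanents, QUATH); "at any rate we'll need some
  separation of classical complexity classes".

**What this file adds.** The technique class as explicit definitions (`PPolyOracleSeparation`:
an oracle language in `P/poly` with `BPP^O ≠ BQP^O`; `PPolyOracleSamplingSeparation`: the same
for the approximate sampling classes), the two printed facts AS PRINTED
(`aaronsonChen2017_thm76 : OWFExist → PPolyOracleSeparation`, `aaronsonChen2017_thm81` with both
printed conclusions), the barrier decl `PPolyOracles` (their conjunction) with the D-0021 block,
and the proved readings: an unconditional `P/poly`-oracle separation (language or sampling form)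
refutes `SampBPP = SampBQP ∧ NP ⊆ BPP` (`not_collapse_of_pPolyOracleSeparation`,
`not_collapse_of_pPolyOracleSamplingSeparation`), and conversely one-way functions suffice
(`pPolyOracleSeparation_of_owf`).

**Status of the two technique-class statements (verdict clean-up, 2026-08-15).**
`PPolyOracleSeparation` and `PPolyOracleSamplingSeparation` are the barrier's TECHNIQUE CLASS
(D-0021: the class of objects the no-go quantifies over — oracle languages `O ∈ P/poly`
exhibiting a quantum/classical separation), NOT results in print, and they are registered here as
OPEN statements (CONVENTIONS §4: docstrings `OPEN CONJECTURE — … [status: open]`), not as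
named-fact debt: no `PPolyOracleSeparation_holds` / `PPolyOracleSamplingSeparation_holds` is to be
expected. Re-verified against the source: the unconditional statements are POSED as a question,
§1.3 (p. 9): "But what if our sampling algorithms know only that small circuits for `f` exist,
without knowing what they are? Could quantum supremacy be proven unconditionally then?", and §9,
Open Problem (7) (p. 34): "we showed that there is an oracle `O` in `P/poly` separating `BPP` from
`BQP`, assuming that one-way functions exist. Is it possible to weaken the assumption to, say,
`NP ⊄ BPP`?"; they are PROVED there only conditionally — Thm. 7.6 (p. 30, language form, under
one-way functions; vendored as `aaronsonChen2017_thm76 : OWFExist → PPolyOracleSeparation`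
below) and §1.3 (p. 10, sampling form: "Relative to some efficiently computable oracle, we can
prove `SampBPP ≠ SampBQP`, but only under a weak computational assumption, like the existence of
one-way functions"; PROVED from the language form: with the two model bridges as hypotheses in
the sibling `PPolyOraclesProofs.lean` (`pPolyOracleSamplingSeparation_of_pPolyOracleSeparation`,
`aaronsonChen2017_thm76_samp_of_parts`), and with both bridges discharged as
`Literature.Barriers.QuantumAdvantage.pPolyOracleSamplingSeparation_of_thm76 :
aaronsonChen2017_thm76 → OWFExist → PPolyOracleSamplingSeparation` in
`PPolyOraclesBridgesProofs.lean` — the separate named fact `aaronsonChen2017_thm76_samp` that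
restated this conditional was merged back into `aaronsonChen2017_thm76`, review of the split,
D-0026) — and an unconditional proof of either
would prove `SampBPP ≠ SampBQP ∨ NP ⊄ BPP` (Thm. 8.1, p. 32: "It is therefore natural to ask
whether we can prove the same statements unconditionally. In this section, we show that at least
some complexity assumptions are needed"; proved readings `sampP_ne_or_NP_not_subset` below and
`sampP_ne_or_NP_not_subset_of_samplingSeparation` in `PPolyOraclesProofs.lean`). So the printed,
citable conditionals already live in the tree under their own names and nothing is restated here;
both technique-class names are KEPT (not renamed `…Conjecture`) because
`PPolyOraclesProofs.lean`, `PPolyOraclesBridges.lean`, `PPolyOraclesBridgesProofs.lean`,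
`PPolyOraclesSampToLanguage.lean`, `PPolyOraclesThm76.lean`, `PPolyOracleSeparationProofs.lean`
and `Literature/Computability/Cryptography/ZhandryPRFMod.lean` use them under these names; the
Lean statements are unchanged.

## Design notes

* Classes: `PPoly`, `NP`, `BPP` (G01), `BPPRel (Oracle.ofLanguage O)`, `BQPRel O` (Q2, XOR-query
  gates), `SampP` (= Aaronson–Chen's `SampBPP`) and `SampBQP` (Q6 `SamplingProblems.lean`),
  `SampPRel`, `SampBQPRel` (sibling entry); one-way functions = the tree's uniform `OWFExist`
  (`OneWayFunctions.lean`, PPT inverters — Aaronson–Chen need classical hardness only).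
* `BPP^O ≠ BQP^O` and the equalities of Thm. 8.1 are typed literally as (in)equalities of the
  tree's classes.

## Sources

* [AaronsonChen2017] arXiv:1612.05903 (read via `lit read arxiv:1612.05903`): §1 (pp. 9–10),
  Thm. 7.6 (p. 30), Thm. 7.7 (p. 30), Thm. 8.1 and Lemma 8.2 (p. 32, PAC-learning simulation),
  §9 Open Problem (7) (p. 34); re-read 2026-08-15 for the verdict clean-up (§1.3 pp. 9–10, §7.3
  p. 30, §8 p. 32, §9 p. 34).
-/

noncomputable section

namespace Literature.Barriers.QuantumAdvantage

open _root_.Computability Literature.Computability.Complexity Literature.Computability.Complexity.Nondeterministic Literature.Computability.Cryptography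

/-! ### The technique class: separations relative to `P/poly` oracles -/

/-- OPEN CONJECTURE — **technique class (language form)** of this barrier, a registered open
statement and not a named fact: **there is an EFFICIENTLY COMPUTABLE oracle separating `BPP`
from `BQP`**, i.e. an oracle language `O ∈ P/poly` with `BPP^O ≠ BQP^O` — the "interpolation"
between black-box separations and the summit proposed by Aaronson–Chen. POSED (as the question
whether it can be proved unconditionally) in S. Aaronson, L. Chen, *Complexity-theoretic
foundations of quantum supremacy experiments*, CCC 2017, §1.3 (p. 9): "Could quantum supremacy
be proven unconditionally then?", and §9, Open Problem (7) (p. 34): "we showed that there is an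
oracle `O` in `P/poly` separating `BPP` from `BQP`, assuming that one-way functions exist. Is it
possible to weaken the assumption to, say, `NP ⊄ BPP`?"
[cite: AaronsonChen2017, §1.3 (p. 9) and §9 Open Problem (7) (p. 34)] [status: open].
Not a printed theorem: the source proves it only under one-way functions (Thm. 7.6, p. 30 — the
named fact `aaronsonChen2017_thm76 : OWFExist → PPolyOracleSeparation` below), and by Thm. 8.1
(p. 32) an unconditional proof would prove `SampBPP ≠ SampBQP ∨ NP ⊄ BPP`
(`sampP_ne_or_NP_not_subset`); conversely `BPP ≠ BQP` already implies it at the empty oracle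
(`pPolyOracleSeparation_of_BPP_ne_BQP`, `PPolyOracleSeparationProofs.lean`). Hence no
`PPolyOracleSeparation_holds` is to be expected; use it only as a hypothesis
`(hsep : PPolyOracleSeparation)`. Name and statement kept (users in six sibling files and in
`Cryptography/ZhandryPRFMod.lean`); verdict of the tenured prove-seat (open problem /
not-a-fact), re-verified 2026-08-15 against arXiv:1612.05903 §1.3, §7.3, §8, §9. -/
@[conjecture] def PPolyOracleSeparation : Prop :=
  ∃ O : Language Bool, O ∈ PPoly ∧ BPPRel (Oracle.ofLanguage O) ≠ BQPRel O

/-- OPEN CONJECTURE — **technique class (sampling form)** of this barrier, a registered open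
statement and not a named fact: **there is an efficiently computable oracle separating the
approximate sampling classes**, i.e. an oracle language `O ∈ P/poly` with
`SampBPP^O ≠ SampBQP^O` (relativized sampling classes `SampPRel`, `SampBQPRel` of the sibling
entry). POSED (as the question whether it can be proved unconditionally) in Aaronson–Chen, CCC
2017, §1.3 (p. 9): "what happens if we consider quantum sampling algorithms that can access an
oracle, but we impose a constraint that the oracle has to be 'physically realistic'? … Could
quantum supremacy be proven unconditionally then?", answered there only conditionally and with a
converse, §8 (p. 32): "It is therefore natural to ask whether we can prove the same statements
unconditionally. In this section, we show that at least some complexity assumptions are needed."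
[cite: AaronsonChen2017, §1.3 (pp. 9–10) and §8 (p. 32)] [status: open].
Not a printed theorem (verdict of the tenured prove-seat: misstated AS A FACT — the source never
asserts the unconditional statement): what is printed is (i) the CONDITIONAL, §1.3 (p. 10):
"Relative to some efficiently computable oracle, we can prove `SampBPP ≠ SampBQP`, but only under
a weak computational assumption, like the existence of one-way functions" (Thm. 7.6 prints the
language form), PROVED in the tree from the language-form fact `aaronsonChen2017_thm76` below:
`Literature.Barriers.QuantumAdvantage.pPolyOracleSamplingSeparation_of_thm76 :
aaronsonChen2017_thm76 → OWFExist → PPolyOracleSamplingSeparation`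
(`PPolyOraclesBridgesProofs.lean`, both model bridges discharged; with the bridges as hypotheses
already in `PPolyOraclesProofs.lean`, `pPolyOracleSamplingSeparation_of_pPolyOracleSeparation`,
`aaronsonChen2017_thm76_samp_of_parts` — the separate named fact `aaronsonChen2017_thm76_samp`
that restated this conditional was merged back into `aaronsonChen2017_thm76`, review of the
split, D-0026), and (ii) the CONVERSE Thm. 8.1
(`aaronsonChen2017_thm81` below): an unconditional proof would prove
`SampBPP ≠ SampBQP ∨ NP ⊄ BPP` (`not_collapse_of_pPolyOracleSamplingSeparation`). Hence no
`PPolyOracleSamplingSeparation_holds` is to be expected; use it only as a hypothesis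
`(hsep : PPolyOracleSamplingSeparation)`. Name and statement kept (users in
`PPolyOraclesProofs.lean`, `PPolyOraclesBridges.lean`, `PPolyOraclesBridgesProofs.lean`,
`PPolyOraclesSampToLanguage.lean`); re-verified 2026-08-15 against arXiv:1612.05903 §1.3, §8. -/
def PPolyOracleSamplingSeparation : Prop :=
  ∃ O : Language Bool, O ∈ PPoly ∧ SampPRel (Oracle.ofLanguage O) ≠ SampBQPRel O

/-! ### The printed facts -/

/-- **Aaronson–Chen 2017, Thm. 7.6**: "Assuming one-way functions exist, there exists an oracle
`O ∈ P/poly` such that `BPP^O ≠ BQP^O`." [cite: AaronsonChen2017, Thm. 7.6]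
Discharge status: the printed proof (p. 30) is a theorem of the tree except for the CITED
Lemma 7.4 step "one-way functions ⟹ pseudorandom generators" (Håstad–Impagliazzo–Levin–Luby, the
named fact `Literature.Computability.Cryptography.PRGExist_iff_OWFExist`): §7.2–7.3 from a secure
PRP is `aaronsonChen2017_thm76_of_prp_holds`, and `PRGExist → PPolyOracleSeparation`,
`aaronsonChen2017_thm76_of_HILL : PRGExist_iff_OWFExist → aaronsonChen2017_thm76` are proved in
`PPolyOraclesHolds.lean`; `aaronsonChen2017_thm76_holds` is the latter applied to
`PRGExist_iff_OWFExist_holds` once HILL lands. [cite: AaronsonChen2017, Lemma 7.4 (p. 29)]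
[cite: HastadImpagliazzoLevinLuby1999, Thm. 1.1] -/
def aaronsonChen2017_thm76 : Prop :=
  Summit.PneNP.PneNP.OWFExist → PPolyOracleSeparation

/-- **Aaronson–Chen 2017, Thm. 8.1**: "Suppose `SampBPP = SampBQP` and `NP ⊆ BPP`. Then for every
oracle `O ∈ P/poly`, we have `SampBPP^O = SampBQP^O` (and consequently `BPP^O = BQP^O`)."
[cite: AaronsonChen2017, Thm. 8.1]
Typed over the tree's `SampP`, whose samplers may read advice off their coin budget, the
hypothesis `SampP = SampBQP` is refuted in the tree (`sampP_ne_sampBQP`,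
`SamplingProblemsCardinality.lean`), so this statement is discharged VACUOUSLY
(`aaronsonChen2017_thm81_holds`, `PPolyOraclesLemma82Proofs.lean`); the printed hypothesis concerns
uniform samplers, `UniformSampP = SampBQP` (`SamplingProblemsUniform.lean`), see `scope_caveats`
of `PPolyOracles`. Statement unchanged (consumed by nine sibling files).
[cite: AaronsonChen2017, Def. 2.3 (p. 12)] -/
def aaronsonChen2017_thm81 : Prop :=
  SampP = SampBQP → NP ⊆ BPP → ∀ O : Language Bool, O ∈ PPoly →
    SampPRel (Oracle.ofLanguage O) = SampBQPRel O ∧ BPPRel (Oracle.ofLanguage O) = BQPRel O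

/-! ### The barrier -/

/-- **`P/poly`-oracle separations need unrelativized assumptions** (Aaronson–Chen Thms. 7.6,
8.1): the conjunction of the two printed facts.

BARRIER
technique_class: efficiently-computable oracles, P/poly oracles, physically-realistic oracles, non-black-box oracle separations, pseudorandom functions
blocks: proving quantum advantage UNCONDITIONALLY by separating quantum from classical computation relative to an efficiently computable oracle (`PPolyOracleSeparation` / `PPolyOracleSamplingSeparation`, in lieu of the summit `QuantumAdvantage` or of `SampBPP ≠ SampBQP`): any such separation already proves `SampBPP ≠ SampBQP ∨ NP ⊄ BPP` (`aaronsonChen2017_thm81`; proved readings `not_collapse_of_pPolyOracleSeparation`, `not_collapse_of_pPolyOracleSamplingSeparation`) — "if we want to separate quantum from classical approximate sampling relative to efficiently computable oracles, then we need to assume something about the unrelativized world" [cite: AaronsonChen2017, Thm. 8.1 and §1 (p. 9)].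
because: under `NP ⊆ BPP` a classical sampler can PAC-learn, query by query, approximators for the unknown polynomial-size circuit behind each oracle gate, and under `SampBPP = SampBQP` it can simulate the remaining oracle-free quantum sampling, with total variation error `ε` for every `O ∈ SIZE(q(n))` [cite: AaronsonChen2017, Lemma 8.2 and its proof (p. 32)].
evasions_known: a "weak computational assumption" suffices: if (classically hard) one-way functions exist then some `O ∈ P/poly` has `BPP^O ≠ BQP^O`, indeed `BQP^O ⊄ SZK^O` (`aaronsonChen2017_thm76`, via Zhandry / Servedio–Gortler pseudorandom constructions) [cite: AaronsonChen2017, Thm. 7.6 and §1 (p. 9)]; under subexponentially strong one-way functions, approximate Fourier Sampling / Fourier Fishing on `P/poly` functions stay classically hard, "a very standard and minimal cryptographic assumption is enough" for an IQP-like experiment in this model [cite: AaronsonChen2017, Thm. 7.7 and §1 (p. 9)]; relative to unrestricted (even random) oracles `SampBPP ≠ SampBQP` holds unconditionally [cite: AaronsonChen2017, §1 (p. 10)].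
scope_caveats: the barrier is the implication of Thm. 8.1 only — it does not say `P/poly`-oracle separations are false, and its hypothesis `NP ⊆ BPP` is itself disbelieved; "unconditional" refers to the unrelativized assumptions `SampBPP = SampBQP`, `NP ⊆ BPP`; models: `PPoly` = G01 polynomial-size circuits, `BQPRel`/`SampBQPRel` with XOR-query gates to the oracle language, `SampPRel` over C4a transcript adversaries (sibling entry), `OWFExist` = the tree's uniform PPT one-wayness (the paper needs classical hardness only) [cite: AaronsonChen2017, §1 (p. 9)]; `BQP^O ⊄ SZK^O` of Thm. 7.6's strengthening is not typed (no `SZK` in the tree); VACUITY AS TYPED: the tree's `SampP` lets a sampler read advice off its polynomially bounded coin budget, so `SampP ≠ SampBQP` is a tree THEOREM (`Literature.Computability.Cryptography.sampP_ne_sampBQP`, `SamplingProblemsCardinality.lean`) and the conjunct `aaronsonChen2017_thm81` — hence the `blocks:` implication and the readings below — holds vacuously in the tree (`aaronsonChen2017_thm81_holds`, `PPolyOraclesLemma82Proofs.lean`); the printed hypothesis "SampBPP = SampBQP" is about uniform machines ("a probabilistic polynomial-time algorithm"), i.e. `UniformSampP = SampBQP` over the tree's corrected class `Literature.Computability.Cryptography.UniformSampP`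 (`SamplingProblemsUniform.lean`), for which Lemma 8.2's learning simulation is NOT discharged in the tree — so nothing proved here bears on the printed barrier's strength [cite: AaronsonChen2017, Def. 2.3 (p. 12) and Thm. 8.1 (p. 32)].
status: established (theorems in print, vendored as named facts; readings proved here) [cite: AaronsonChen2017, Thm. 7.6, Thm. 8.1] -/
def PPolyOracles : Prop :=
  aaronsonChen2017_thm76 ∧ aaronsonChen2017_thm81

/-- Projection. [cite: AaronsonChen2017, Thm. 7.6] -/
theorem PPolyOracles.thm76 (h : PPolyOracles) : aaronsonChen2017_thm76 :=
  h.1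

/-- Projection. [cite: AaronsonChen2017, Thm. 8.1] -/
theorem PPolyOracles.thm81 (h : PPolyOracles) : aaronsonChen2017_thm81 :=
  h.2

/-! ### The readings (proved) -/

/-- **An unconditional `P/poly`-oracle separation of `BPP` from `BQP` refutes
`SampBPP = SampBQP ∧ NP ⊆ BPP`.** [cite: AaronsonChen2017, Thm. 8.1 and §1 (p. 9)] -/
theorem not_collapse_of_pPolyOracleSeparation (h : aaronsonChen2017_thm81)
    (hsep : PPolyOracleSeparation) : ¬ (SampP = SampBQP ∧ NP ⊆ BPP) := by
  rintro ⟨hS, hNP⟩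
  obtain ⟨O, hO, hne⟩ := hsep
  exact hne (h hS hNP O hO).2

/-- The same for the sampling form. [cite: AaronsonChen2017, Thm. 8.1] -/
theorem not_collapse_of_pPolyOracleSamplingSeparation (h : aaronsonChen2017_thm81)
    (hsep : PPolyOracleSamplingSeparation) : ¬ (SampP = SampBQP ∧ NP ⊆ BPP) := by
  rintro ⟨hS, hNP⟩
  obtain ⟨O, hO, hne⟩ := hsep
  exact hne (h hS hNP O hO).1

/-- Disjunctive form: a `P/poly`-oracle separation yields `SampBPP ≠ SampBQP` or `NP ⊄ BPP`
("either … (in which case we wouldn't even need an oracle), or else `NP ⊄ BPP`").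
[cite: AaronsonChen2017, §1 (p. 9)] -/
theorem sampP_ne_or_NP_not_subset (h : aaronsonChen2017_thm81) (hsep : PPolyOracleSeparation) :
    SampP ≠ SampBQP ∨ ¬ NP ⊆ BPP := by
  by_cases hS : SampP = SampBQP
  · exact Or.inr fun hNP => not_collapse_of_pPolyOracleSeparation h hsep ⟨hS, hNP⟩
  · exact Or.inl hS

/-- **Converse direction (evasion): one-way functions suffice** for a `P/poly`-oracle
separation. [cite: AaronsonChen2017, Thm. 7.6] -/
theorem pPolyOracleSeparation_of_owf (h : aaronsonChen2017_thm76) (howf : Summit.PneNP.PneNP.OWFExist) :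
    PPolyOracleSeparation :=
  h howf

/-- Under `SampBPP = SampBQP ∧ NP ⊆ BPP` no language oracle in `P/poly` separates even the
language classes. [cite: AaronsonChen2017, Thm. 8.1] -/
theorem not_pPolyOracleSeparation_of_collapse (h : aaronsonChen2017_thm81) (hS : SampP = SampBQP)
    (hNP : NP ⊆ BPP) : ¬ PPolyOracleSeparation :=
  fun hsep => not_collapse_of_pPolyOracleSeparation h hsep ⟨hS, hNP⟩

end Literature.Barriers.QuantumAdvantage

end
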